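/-
Origin: expansion seat `literature-prover-pub-hodgecm-cf-hasseminkowski-g5-0`, handover #6 2026-08-18T06:34:00Z (`HOME/pub-hodgecm-cf-hasseminkowski-g5/handover/HodgeCM/Literature/ClassBaseChangeParity.lean`, md5 27a0eb7d, 145 lines);
landed by the gen-7 packager in gate run 25 as `HodgeCM/Literature/ClassBaseChangeParity.lean` (verbatim).
-/
/-
Origin: CITED-FACT seat (4), unit `pub-hodgecm-cf-hasseminkowski-g5` (session literature-prover-pub-hodgecm-cf-hasseminkowski-g5-0),
HodgeCM publication cell, 2026-08-18.  Intended landing: `HodgeCM/Literature/ClassBaseChangeParity.lean` (after `ClassBaseChangeCompat.lean`).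
-/
import Summits.HodgeConjecture.HodgeCM.Literature.ClassBaseChangeCompat
import Summits.HodgeConjecture.HodgeCM.PerL34.RealPlaceSigns

/-!
# N15 with PerL's parity condition "`m_b ≡ m (mod 2)`" — and the even case with NO input at all

PerL v5 §3.2, tex ll. 305–307 (node N15): "unitary Hecke characters of `L` with prescribed components `(z/|z|)^{m_b}`
at the complex places and prescribed restriction `ε^m_{L/L₀}` to `𝔸^×_{L₀}`, all `m_b ≡ m (mod 2)`, exist: the two
prescriptions agree on `L^×_∞ ∩ 𝔸^×_{L₀} = L^×_{0,∞}` …".  `ClassBaseChangeCompat.lean` reduced everything to the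
archimedean compatibility `harch`; pv10's `RealPlaceSigns` has its local content (`(x/|x|)^{m_b} = (x/|x|)^m` on `ℝˣ` iff
`m_b ≡ m (2)`).  This file globalises that computation over the ACTUAL base change at infinity:

* `ClassBaseChange.infLocalUnits_infBaseChange` (K totally real): the `w`-component of `y_L`, read in `ℂ`, is the REAL number
  `y_{w|K}` — because `K_v → L_w` fixes the canonical `ℝ` (`infiniteCompletionOfComap_realToCompletion`);
* `harch_of_parity`: if `χA` has archimedean type `(m, …, m)` on `K_∞^×` — which is what "restriction `ε^m_{L/L₀}`"
  says at infinity, `ε_v = sgn` at the real places — and `e_w ≡ m (mod 2)` for all `w`, then `harch` holds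
  (for `w ↦ w|K` injective, e.g. CM);
* **`exists_unitaryHeckeCharacter_of_isCMField_parity`**: N15 in PerL's own form — inputs: an integer `m`, an infinity
  type `e` with `e_w ≡ m (mod 2)`, and a continuous character `χA` of `C_{L⁺}` of archimedean type `(m,…,m)` (PerL:
  `χA = ε^m_{L/L₀}`, whose existence for odd `m` is class field theory and is the ONLY thing not constructed here);
* **`exists_unitaryHeckeCharacter_trivial_of_even`**: for `e` with all `e_w` EVEN, a unitary Hecke character of the CM
  field `L` of infinity type `e` and TRIVIAL on the image of `C_{L⁺}` exists — N15 for even `m` with no input whatsoever.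

No PerL/QW8/2001 statement is used; no named fact is introduced; everything below is proved.
-/

set_option autoImplicit false

noncomputable section

open NumberField InfinitePlace NumberField.InfinitePlace.Completion

namespace NumberField

open Literature.NumberTheory Literature.NumberTheory.Automorphic InfiniteAdeleRing

variable (K L : Type) [Field K] [NumberField K] [Field L] [NumberField L] [Algebra K L]

namespace ClassBaseChange

omit [NumberField K] in
/-- At a real place `v`, every element of `K_v` is `realToCompletion` of a real number. -/
theorem realToCompletion_ringEquivRealOfIsReal {v : InfinitePlace K} (hv : v.IsReal) (t : v.Completion) :
    realToCompletion K v (ringEquivRealOfIsReal hv t) = t := by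
  unfold realToCompletion
  rw [dif_pos hv, RingEquiv.toRingHom_eq_coe, RingHom.coe_coe, RingEquiv.symm_apply_apply]

/-- The real coordinates of an infinite idele of a field all of whose infinite places are real. -/
def realCoord (hK : ∀ v : InfinitePlace K, v.IsReal) (y : (InfiniteAdeleRing K)ˣ) (v : InfinitePlace K) : ℝˣ :=
  Units.mk0 (ringEquivRealOfIsReal (hK v) ((y : InfiniteAdeleRing K) v)) (by
    rw [map_ne_zero_iff _ (ringEquivRealOfIsReal (hK v)).injective]
    exact (Units.map (evalRingHom K v).toMonoidHom y).ne_zero)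

omit [NumberField K] in
/-- (Ported verbatim from the HodgeCMPerL package; no docstring in the source.) -/
theorem realToCompletion_realCoord (hK : ∀ v : InfinitePlace K, v.IsReal) (y : (InfiniteAdeleRing K)ˣ)
    (v : InfinitePlace K) : realToCompletion K v (realCoord K hK y v : ℝ) = (y : InfiniteAdeleRing K) v :=
  realToCompletion_ringEquivRealOfIsReal K (hK v) _

omit [NumberField K] in
/-- The `v`-component of `y`, read in `ℂ`, is the real number `realCoord y v`. -/
theorem infLocalUnits_eq_ofRealUnits (hK : ∀ v : InfinitePlace K, v.IsReal) (y : (InfiniteAdeleRing K)ˣ)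
    (v : InfinitePlace K) : infLocalUnits K v y = Complex.ofRealUnits (realCoord K hK y v) := by
  refine Units.ext ?_
  rw [coe_infLocalUnits, Complex.coe_ofRealUnits, ← realToCompletion_realCoord K hK y v,
    extensionEmbedding_realToCompletion]

omit [NumberField K] [NumberField L] in
/-- The `w`-component of the base change `y_L`, read in `ℂ`, is the SAME real number `realCoord y (w|K)`
(`K_v → L_w` fixes the canonical `ℝ`). -/
theorem infLocalUnits_infBaseChange (hK : ∀ v : InfinitePlace K, v.IsReal) (y : (InfiniteAdeleRing K)ˣ)
    (w : InfinitePlace L) :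
    infLocalUnits L w (infBaseChange K L y) = Complex.ofRealUnits (realCoord K hK y (w.comap (algebraMap K L))) := by
  refine Units.ext ?_
  rw [coe_infLocalUnits, Complex.coe_ofRealUnits, coe_infBaseChange, InfiniteAdeleRing.baseChange_apply,
    ← realToCompletion_realCoord K hK y (w.comap (algebraMap K L)), infiniteCompletionOfComap_realToCompletion,
    extensionEmbedding_realToCompletion]

/-- **`harch` from parity** (PerL l. 307 "all `m_b ≡ m (mod 2)` … the two prescriptions agree on `L^×_{0,∞}`"):
`K` totally real, every infinite place of `K` with a unique place of `L` above it, `χA` of archimedean type `(m,…,m)`,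
`e ≡ m (mod 2)` componentwise. -/
theorem harch_of_parity (hK : ∀ v : InfinitePlace K, v.IsReal)
    (hinj : Function.Injective fun w : InfinitePlace L => w.comap (algebraMap K L))
    (m : ℤ) (e : InfinitePlace L → ℤ) (he : ∀ w, e w ≡ m [ZMOD 2])
    (χA : IdeleClassGroup K →* Circle)
    (hχ : ∀ y : (InfiniteAdeleRing K)ˣ, χA (infUnitsToClass K y) = infinityTypeChar K (fun _ => m) y)
    (y : (InfiniteAdeleRing K)ˣ) :
    χA (infUnitsToClass K y) = infinityTypeChar L e (infBaseChange K L y) := by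
  have hbij : Function.Bijective fun w : InfinitePlace L => w.comap (algebraMap K L) := ⟨hinj, comap_surjective⟩
  rw [hχ, infinityTypeChar_apply, infinityTypeChar_apply]
  simp only [infLocalUnits_eq_ofRealUnits K hK, infLocalUnits_infBaseChange K L hK]
  rw [← Fintype.prod_equiv (Equiv.ofBijective _ hbij)
    (fun w => Complex.unitPart (Complex.ofRealUnits (realCoord K hK y (w.comap (algebraMap K L)))) ^ e w)
    (fun v => Complex.unitPart (Complex.ofRealUnits (realCoord K hK y v)) ^ m)
    (fun w => Complex.unitPart_ofRealUnits_zpow_congr _ (he w))]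

end ClassBaseChange

/-! ### CM assembly -/

section CM

variable (L : Type) [Field L] [NumberField L] [IsCMField L]

/-- **N15 in PerL's form (tex ll. 305–313) for a CM field over its maximal real subfield.**  Given an integer `m`, an
infinity type `e = (m_b)_b` with `m_b ≡ m (mod 2)`, and a continuous character `χA` of `C_{L⁺}` whose restriction to
`(L⁺_∞)^×` is `y ↦ ∏_v sgn(y_v)^m` (PerL: `χA = ε^m_{L/L₀}`), there is a unitary Hecke character `ψ` of `L` with
components `(z/|z|)^{m_b}` at the complex places and `ψ ∘ ι = χA` on `C_{L⁺}`.  Every step KERNEL; the existence of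
`ε_{L/L₀}` itself (class field theory) is the only thing PerL uses that is not constructed in this package. -/
theorem exists_unitaryHeckeCharacter_of_isCMField_parity (m : ℤ) (e : InfinitePlace L → ℤ)
    (he : ∀ w, e w ≡ m [ZMOD 2])
    (χA : IdeleClassGroup (maximalRealSubfield L) →* Circle) (hχA : Continuous χA)
    (hχ : ∀ y : (InfiniteAdeleRing (maximalRealSubfield L))ˣ,
      χA (infUnitsToClass (maximalRealSubfield L) y) = infinityTypeChar (maximalRealSubfield L) (fun _ => m) y) :
    ∃ ψ : UnitaryHeckeCharacter L, ψ.HasInfinityType L e ∧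
      ∀ a, ψ (classBaseChange (maximalRealSubfield L) L a) = χA a :=
  exists_unitaryHeckeCharacter_of_isCMField_arch L χA hχA e
    (ClassBaseChange.harch_of_parity (maximalRealSubfield L) L
      (fun v => IsTotallyReal.isReal v) (comap_injective_of_isCMField L) m e he χA hχ)

/-- **N15, even case, NO input**: for a CM field `L` and an infinity type `e` with all `e_w` even there is a unitary
Hecke character of `L` of infinity type `e` (components `(z/|z|)^{e_w}`) which is TRIVIAL on the image of `C_{L⁺}`
(PerL's `μ` with `m` even: restriction `ε^m_{L/L₀} = 1`). -/
theorem exists_unitaryHeckeCharacter_trivial_of_even (e : InfinitePlace L → ℤ) (he : ∀ w, Even (e w)) :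
    ∃ ψ : UnitaryHeckeCharacter L, ψ.HasInfinityType L e ∧
      ∀ a, ψ (classBaseChange (maximalRealSubfield L) L a) = 1 := by
  have he' : ∀ w, e w ≡ 0 [ZMOD 2] := fun w => by
    obtain ⟨k, hk⟩ := he w
    exact Int.modEq_zero_iff_dvd.mpr ⟨k, by rw [hk]; ring⟩
  have h1 : ∀ y : (InfiniteAdeleRing (maximalRealSubfield L))ˣ,
      (1 : IdeleClassGroup (maximalRealSubfield L) →* Circle) (infUnitsToClass (maximalRealSubfield L) y) =
        infinityTypeChar (maximalRealSubfield L) (fun _ => (0 : ℤ)) y := fun y => by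
    rw [MonoidHom.one_apply, infinityTypeChar_apply]
    simp only [zpow_zero, Finset.prod_const_one]
  obtain ⟨ψ, hψ, hψA⟩ := exists_unitaryHeckeCharacter_of_isCMField_parity L 0 e he' 1 continuous_const h1
  exact ⟨ψ, hψ, fun a => by rw [hψA, MonoidHom.one_apply]⟩

end CM

end NumberField

end
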